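import Literature.Geometry.Kaehler.OsculatingUnitaryFrameProofs
import Literature.Analysis.OperatorTheory.LocalSqrtNearOneAnalyticProofs

/-!
# The osculating unitary frame `M y = √(Q y) ∘ A y`: isometry, `DM(c) = B`, smoothness, `ℂ`-linearity

Sequel to `OsculatingUnitaryFrameProofs.lean` (notation and hypotheses as there: a positive definite
symmetric `g₀` with Riesz map `S`, the coordinate metric `Ĝ` with `Ĝ c = g₀`, the Koszul map `B`
of its first jet, `A y = 1 + B(y - c)`, the `g₀`-Gram operator `Q y` of the transported metric).
With the smooth square root `√` near `1` of the Banach algebra `E →L[ℝ] E`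
(`LocalSqrtNearOne*Proofs.lean`) put `R y = √(Q y)` and `M y = R y ∘ A y`. Then, near `c`:

* `R y` is `g₀`-self-adjoint (`√` of a self-adjoint operator, by uniqueness of the square root:
  `eventually_localSqrt_fixed_of_antihom` for the `g₀`-transpose), `R y ∘ R y = Q y`, `R c = 1`;
* **isometry** `g₀ (M y a) (M y b) = Ĝ y a b` (`eventually_frameM_isometry`): `M y` maps the metric
  `Ĝ y` to the constant metric `g₀` — the unitary frame;
* `M c = 1` and **`DM(c) = B`** (`hasFDerivAt_frameM`; in particular `DM(c) u v = B u v` is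
  *symmetric* in `u, v`): differentiate the isometry relation (`g₀ (M'a) b + g₀ a (M'b) = DĜ`) and the
  self-adjointness of `R` — the `g₀`-skew and `g₀`-self-adjoint parts of `M' - B = R'` both vanish;
* smoothness of `M` at every point near `c` (`eventually_contDiffAt_frameM`);
* **`ℂ`-linearity** (`eventually_frameM_comm`): if `g₀` and all `Ĝ y` are Hermitian for a complex
  structure `J` and `B` is `ℂ`-bilinear (the Kähler condition, `koszul_J'`), then `M y ∘ J = J ∘ M y`.

These are exactly the properties making the test forms `η ∘ (M y)^{⊗k}` (pulled back to the
manifold) osculate the constant forms: they are exchanged with `ω ∧ ·`, `⋆` and the `(p,q)`-types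
by `M`, and have vanishing exterior derivative at `c` (symmetry of `DM(c)`). Voisin (2002),
Prop. 3.14 (osculation of a Kähler metric), proof of Prop. 6.5.

## References

* C. Voisin, *Hodge Theory and Complex Algebraic Geometry I* (2002), Prop. 3.14, Prop. 6.5.
  [Voisin2002]
-/

noncomputable section

open scoped Topology ContDiff
open Filter ContinuousLinearMap Literature.Analysis.OperatorTheory

namespace Literature.Geometry.Kaehler

section FrameSqrt

variable {E : Type*} [NormedAddCommGroup E] [NormedSpace ℝ E] [CompleteSpace E]
  (g₀ : E →L[ℝ] E →L[ℝ] ℝ) (S : (E →L[ℝ] ℝ) →L[ℝ] E) (B : E →L[ℝ] E →L[ℝ] E)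
  (Ĝ : E → E →L[ℝ] E →L[ℝ] ℝ) (c : E)

/-- The `g₀`-transpose of an operator. -/
local notation "σ[" X "]" => ContinuousLinearMap.comp S (ContinuousLinearMap.flip
  (ContinuousLinearMap.comp g₀ X))

/-- `A y = 1 + B(y - c)`. -/
local notation "A[" y "]" => ((1 : E →L[ℝ] E) + B (y - c))

/-- `A y⁻¹`. -/
local notation "Ai[" y "]" => Ring.inverse ((1 : E →L[ℝ] E) + B (y - c))

/-- The transported metric. -/
local notation "Qf[" y "]" => ContinuousLinearMap.bilinearComp (Ĝ y) (Ai[y]) (Ai[y])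

/-- Its Gram operator. -/
local notation "Q[" y "]" => ContinuousLinearMap.comp S (Qf[y])

set_option quotPrecheck false in
/-- The square root near `1` of the Banach algebra `E →L[ℝ] E`. -/
local notation "√₁" => HasStrictFDerivAt.localInverse (fun X : E →L[ℝ] E ↦ X * X)
  (ContinuousLinearEquiv.smulLeft (Units.mk0 (2 : ℝ) two_ne_zero) : (E →L[ℝ] E) ≃L[ℝ] (E →L[ℝ] E))
  1 hasStrictFDerivAt_mul_self_one

/-- `R y = √(Q y)`. -/
local notation "R[" y "]" => √₁ (Q[y])

/-- The osculating unitary frame map `M y = R y ∘ A y`. -/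
local notation "M[" y "]" => (√₁ (Q[y]) * ((1 : E →L[ℝ] E) + B (y - c)))

/-! #### Pulling back the square-root facts along `Q` -/

/-- `Q y → 1` as `y → c`. [folklore] -/
theorem tendsto_frameQ (hpos : ∀ a, a ≠ 0 → 0 < g₀ a a) (hS : ∀ ℓ w, g₀ (S ℓ) w = ℓ w)
    [FiniteDimensional ℝ E] (hĜc : Ĝ c = g₀) (hĜ : ContinuousAt Ĝ c) :
    Tendsto (fun y ↦ Q[y]) (𝓝 c) (𝓝 1) := by
  have h := continuousAt_frameQ S B Ĝ c hĜ
  rw [ContinuousAt, frameQ_apply_c g₀ S B Ĝ c hpos hS hĜc] at h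
  exact h

/-- `R c = 1`. [folklore] -/
theorem frameR_apply_c (hpos : ∀ a, a ≠ 0 → 0 < g₀ a a) (hS : ∀ ℓ w, g₀ (S ℓ) w = ℓ w)
    [FiniteDimensional ℝ E] (hĜc : Ĝ c = g₀) : R[c] = 1 := by
  rw [frameQ_apply_c g₀ S B Ĝ c hpos hS hĜc]
  exact localSqrt_one

/-- `M c = 1`. [folklore] -/
theorem frameM_apply_c (hpos : ∀ a, a ≠ 0 → 0 < g₀ a a) (hS : ∀ ℓ w, g₀ (S ℓ) w = ℓ w)
    [FiniteDimensional ℝ E] (hĜc : Ĝ c = g₀) : M[c] = 1 := by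
  rw [frameR_apply_c g₀ S B Ĝ c hpos hS hĜc, frameA_apply_c B c, mul_one]

/-- `R y ∘ R y = Q y` near `c`. [folklore] -/
theorem eventually_frameR_mul_self (hpos : ∀ a, a ≠ 0 → 0 < g₀ a a)
    (hS : ∀ ℓ w, g₀ (S ℓ) w = ℓ w) [FiniteDimensional ℝ E] (hĜc : Ĝ c = g₀)
    (hĜ : ContinuousAt Ĝ c) : ∀ᶠ y in 𝓝 c, R[y] * R[y] = Q[y] :=
  (tendsto_frameQ g₀ S B Ĝ c hpos hS hĜc hĜ).eventually eventually_localSqrt_mul_self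

/-- `R y` is invertible near `c`. [folklore] -/
theorem eventually_isUnit_frameR (hpos : ∀ a, a ≠ 0 → 0 < g₀ a a)
    (hS : ∀ ℓ w, g₀ (S ℓ) w = ℓ w) [FiniteDimensional ℝ E] (hĜc : Ĝ c = g₀)
    (hĜ : ContinuousAt Ĝ c) : ∀ᶠ y in 𝓝 c, IsUnit R[y] :=
  (tendsto_frameQ g₀ S B Ĝ c hpos hS hĜc hĜ).eventually eventually_isUnit_localSqrt

/-- `M y` is invertible near `c`. [folklore] -/
theorem eventually_isUnit_frameM (hpos : ∀ a, a ≠ 0 → 0 < g₀ a a)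
    (hS : ∀ ℓ w, g₀ (S ℓ) w = ℓ w) [FiniteDimensional ℝ E] (hĜc : Ĝ c = g₀)
    (hĜ : ContinuousAt Ĝ c) : ∀ᶠ y in 𝓝 c, IsUnit M[y] := by
  filter_upwards [eventually_isUnit_frameR g₀ S B Ĝ c hpos hS hĜc hĜ,
    eventually_isUnit_frameA B c] with y hR hA
  exact hR.mul hA

/-- **`R y` is `g₀`-self-adjoint near `c`** (uniqueness of the square root). [folklore] -/
theorem eventually_frameR_selfAdjoint (hpos : ∀ a, a ≠ 0 → 0 < g₀ a a)
    (hsymm : ∀ a b, g₀ a b = g₀ b a) (hS : ∀ ℓ w, g₀ (S ℓ) w = ℓ w) [FiniteDimensional ℝ E]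
    (hĜc : Ĝ c = g₀) (hĜ : ContinuousAt Ĝ c) (hĜsymm : ∀ y a b, Ĝ y a b = Ĝ y b a) :
    ∀ᶠ y in 𝓝 c, ∀ a b, g₀ (R[y] a) b = g₀ a (R[y] b) := by
  have hσ := eventually_localSqrt_fixed_of_antihom (fun X : E →L[ℝ] E ↦ σ[X])
    (bilin_transpose_one g₀ S hpos hsymm hS) (bilin_transpose_mul g₀ S hpos hsymm hS)
    (continuous_bilin_transpose g₀ S).continuousAt
  filter_upwards [(tendsto_frameQ g₀ S B Ĝ c hpos hS hĜc hĜ).eventually hσ] with y hy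
  have hQ : σ[Q[y]] = Q[y] :=
    (bilin_transpose_eq_self_iff g₀ S hpos hsymm hS _).2
      (frameQ_selfAdjoint g₀ S B Ĝ c hsymm hS hĜsymm y)
  exact (bilin_transpose_eq_self_iff g₀ S hpos hsymm hS _).1 (hy hQ)

/-- **`M y` is an isometry `(E, Ĝ y) → (E, g₀)`** near `c`: `g₀ (M y a) (M y b) = Ĝ y a b`.
[cite: Voisin2002, Prop. 3.14] -/
theorem eventually_frameM_isometry (hpos : ∀ a, a ≠ 0 → 0 < g₀ a a)
    (hsymm : ∀ a b, g₀ a b = g₀ b a) (hS : ∀ ℓ w, g₀ (S ℓ) w = ℓ w) [FiniteDimensional ℝ E]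
    (hĜc : Ĝ c = g₀) (hĜ : ContinuousAt Ĝ c) (hĜsymm : ∀ y a b, Ĝ y a b = Ĝ y b a) :
    ∀ᶠ y in 𝓝 c, ∀ a b, g₀ (M[y] a) (M[y] b) = Ĝ y a b := by
  filter_upwards [eventually_frameR_selfAdjoint g₀ S B Ĝ c hpos hsymm hS hĜc hĜ hĜsymm,
    eventually_frameR_mul_self g₀ S B Ĝ c hpos hS hĜc hĜ, eventually_isUnit_frameA B c]
    with y hsa hRR hA a b
  have hinv : ∀ v, Ai[y] (A[y] v) = v := fun v ↦
    congrArg (fun T : E →L[ℝ] E ↦ T v) (Ring.inverse_mul_cancel _ hA)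
  rw [mul_apply_eq_comp, mul_apply_eq_comp, hsa, ← mul_apply_eq_comp (√₁ (Q[y])), hRR, hsymm,
    frameQ_apply g₀ S B Ĝ c hS, hinv, hinv, hĜsymm]

/-! #### Smoothness -/

/-- `R` is `C^∞` at every point near `c` if `Ĝ` is. [folklore] -/
theorem eventually_contDiffAt_frameR (hpos : ∀ a, a ≠ 0 → 0 < g₀ a a)
    (hS : ∀ ℓ w, g₀ (S ℓ) w = ℓ w) [FiniteDimensional ℝ E] (hĜc : Ĝ c = g₀)
    (hĜ : ∀ᶠ y in 𝓝 c, ContDiffAt ℝ ∞ Ĝ y) :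
    ∀ᶠ y in 𝓝 c, ContDiffAt ℝ ∞ (fun y ↦ R[y]) y := by
  have hĜc' : ContinuousAt Ĝ c := (hĜ.self_of_nhds).continuousAt
  filter_upwards [(tendsto_frameQ g₀ S B Ĝ c hpos hS hĜc hĜc').eventually
    eventually_contDiffAt_localSqrt, hĜ, eventually_isUnit_frameA B c] with y hsq hĜy hA
  exact ContDiffAt.comp (f := fun y ↦ Q[y]) y hsq (contDiffAt_frameQ S B Ĝ c hĜy hA)

/-- **`M` is `C^∞` at every point near `c`** if `Ĝ` is. [folklore] -/
theorem eventually_contDiffAt_frameM (hpos : ∀ a, a ≠ 0 → 0 < g₀ a a)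
    (hS : ∀ ℓ w, g₀ (S ℓ) w = ℓ w) [FiniteDimensional ℝ E] (hĜc : Ĝ c = g₀)
    (hĜ : ∀ᶠ y in 𝓝 c, ContDiffAt ℝ ∞ Ĝ y) :
    ∀ᶠ y in 𝓝 c, ContDiffAt ℝ ∞ (fun y ↦ M[y]) y := by
  filter_upwards [eventually_contDiffAt_frameR g₀ S B Ĝ c hpos hS hĜc hĜ] with y hR
  exact hR.mul (contDiff_frameA B c).contDiffAt

/-! #### The derivative at the centre: `DM(c) = B` -/

omit [CompleteSpace E] in
/-- Derivative of `y ↦ g₀ (X y a) (X y b)` for a differentiable operator family `X`. [folklore] -/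
theorem hasFDerivAt_bilin_apply_apply {X : E → E →L[ℝ] E} {X' : E →L[ℝ] E →L[ℝ] E} {y : E}
    (hX : HasFDerivAt X X' y) (a b : E) :
    HasFDerivAt (fun y ↦ g₀ (X y a) (X y b))
      ((g₀.flip (X y b)).comp ((ContinuousLinearMap.apply ℝ E a).comp X') +
        (g₀ (X y a)).comp ((ContinuousLinearMap.apply ℝ E b).comp X')) y := by
  have ha : HasFDerivAt (fun y ↦ X y a) ((ContinuousLinearMap.apply ℝ E a).comp X') y :=
    (ContinuousLinearMap.apply ℝ E a).hasFDerivAt.comp y hX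
  have hb : HasFDerivAt (fun y ↦ X y b) ((ContinuousLinearMap.apply ℝ E b).comp X') y :=
    (ContinuousLinearMap.apply ℝ E b).hasFDerivAt.comp y hX
  have h := (g₀.isBoundedBilinearMap.hasFDerivAt (X y a, X y b)).comp y (ha.prodMk hb)
  refine h.congr_fderiv ?_
  ext u
  simp only [ContinuousLinearMap.comp_apply, IsBoundedBilinearMap.deriv_apply,
    ContinuousLinearMap.prod_apply, _root_.add_apply, ContinuousLinearMap.flip_apply]
  ring

/-- **`DM(c) = B`.** The frame map is differentiable at `c` with derivative the Koszul map: writing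
`M' = DM(c)` and `R' = DR(c)`, the product rule gives `M' u = B u + R' u` (`R c = A c = 1`,
`DA(c) = B`); differentiating the isometry relation `g₀ (M y a) (M y b) = Ĝ y a b` at `c` gives
`g₀ (M' u a) b + g₀ a (M' u b) = D u a b = g₀ (B u a) b + g₀ a (B u b)` (metric compatibility of
`B`), so `R' u` is `g₀`-skew; differentiating `σ (R y) = R y` shows `R' u` is `g₀`-self-adjoint;
hence `R' u = 0` and `M' = B`. [cite: Voisin2002, Prop. 3.14] -/
theorem hasFDerivAt_frameM (hpos : ∀ a, a ≠ 0 → 0 < g₀ a a)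
    (hsymm : ∀ a b, g₀ a b = g₀ b a) (hS : ∀ ℓ w, g₀ (S ℓ) w = ℓ w) [FiniteDimensional ℝ E]
    (hĜc : Ĝ c = g₀) (hĜ : ∀ᶠ y in 𝓝 c, ContDiffAt ℝ ∞ Ĝ y)
    (hĜsymm : ∀ y a b, Ĝ y a b = Ĝ y b a) {D : E →L[ℝ] E →L[ℝ] E →L[ℝ] ℝ} (hĜd : HasFDerivAt Ĝ D c)
    (hBg : ∀ u v w, D u v w = g₀ (B u v) w + g₀ v (B u w)) :
    HasFDerivAt (fun y ↦ M[y]) B c := by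
  have hĜc' : ContinuousAt Ĝ c := (hĜ.self_of_nhds).continuousAt
  -- differentiability of `R` at `c`, `R' := DR(c)`
  have hRd : DifferentiableAt ℝ (fun y ↦ R[y]) c :=
    ((eventually_contDiffAt_frameR g₀ S B Ĝ c hpos hS hĜc hĜ).self_of_nhds).differentiableAt
      (by simp)
  set R' : E →L[ℝ] E →L[ℝ] E := fderiv ℝ (fun y ↦ R[y]) c with hR'
  have hR : HasFDerivAt (fun y ↦ R[y]) R' c := hRd.hasFDerivAt
  -- product rule: `M' u = B u + R' u`
  have hM := hR.mul' (hasFDerivAt_frameA B c)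
  obtain ⟨M', hMd, hM'u⟩ : ∃ M' : E →L[ℝ] E →L[ℝ] E,
      HasFDerivAt (fun y ↦ M[y]) M' c ∧ ∀ u, M' u = B u + R' u := by
    refine ⟨_, hM, fun u ↦ ?_⟩
    rw [_root_.add_apply, _root_.smul_apply, _root_.smul_apply, frameR_apply_c g₀ S B Ĝ c hpos hS hĜc, frameA_apply_c B c,
      MulOpposite.op_one, one_smul, one_smul]
  -- `R' u` is self-adjoint: differentiate `σ (R y) = R y`
  have hsa : ∀ u a b, g₀ (R' u a) b = g₀ a (R' u b) := by
    intro u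
    set L : (E →L[ℝ] E) →L[ℝ] (E →L[ℝ] E) := (ContinuousLinearMap.compL ℝ E (E →L[ℝ] ℝ) E S).comp
      (((ContinuousLinearMap.flipₗᵢ ℝ E E ℝ).toContinuousLinearEquiv :
        (E →L[ℝ] E →L[ℝ] ℝ) →L[ℝ] (E →L[ℝ] E →L[ℝ] ℝ)).comp
        (ContinuousLinearMap.compL ℝ E E (E →L[ℝ] ℝ) g₀)) with hL
    have hLapp : ∀ X, L X = σ[X] := fun X ↦ by
      simp only [hL, ContinuousLinearMap.comp_apply, ContinuousLinearMap.compL_apply,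
        ContinuousLinearEquiv.coe_coe, LinearIsometryEquiv.coe_toContinuousLinearEquiv,
        ContinuousLinearMap.coe_flipₗᵢ]
    have eL : (fun y ↦ σ[R[y]]) = ⇑L ∘ fun y ↦ R[y] := by
      funext y
      rw [Function.comp_apply, hLapp]
    have hev : (⇑L ∘ fun y ↦ R[y]) =ᶠ[𝓝 c] fun y ↦ R[y] := by
      rw [← eL]
      filter_upwards [eventually_frameR_selfAdjoint g₀ S B Ĝ c hpos hsymm hS hĜc hĜc' hĜsymm]
        with y hy
      exact (bilin_transpose_eq_self_iff g₀ S hpos hsymm hS _).2 hy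
    have h1 : HasFDerivAt (⇑L ∘ fun y ↦ R[y]) (L.comp R') c := L.hasFDerivAt.comp c hR
    have h2 : HasFDerivAt (⇑L ∘ fun y ↦ R[y]) R' c := hR.congr_of_eventuallyEq hev
    have heq := h1.unique h2
    intro a b
    have hu : σ[R' u] = R' u := by
      rw [← hLapp]
      exact congrArg (fun T : E →L[ℝ] E →L[ℝ] E ↦ T u) heq
    exact (bilin_transpose_eq_self_iff g₀ S hpos hsymm hS _).1 hu a b
  -- the isometry relation differentiated: `g₀ (M' u a) b + g₀ a (M' u b) = D u a b`
  have hiso : ∀ u a b, g₀ (M' u a) b + g₀ a (M' u b) = D u a b := by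
    intro u a b
    have hev : (fun y ↦ g₀ ((fun y ↦ M[y]) y a) ((fun y ↦ M[y]) y b)) =ᶠ[𝓝 c]
        fun y ↦ Ĝ y a b := by
      filter_upwards [eventually_frameM_isometry g₀ S B Ĝ c hpos hsymm hS hĜc hĜc' hĜsymm]
        with y hy
      exact hy a b
    have h1 := hasFDerivAt_bilin_apply_apply g₀ hMd a b
    -- derivative of `y ↦ Ĝ y a b` is `u ↦ D u a b`
    have h2a : HasFDerivAt (fun y ↦ Ĝ y a) ((Ĝ c).comp (0 : E →L[ℝ] E) + D.flip a) c :=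
      hĜd.clm_apply (hasFDerivAt_const a c)
    have h2 : HasFDerivAt (fun y ↦ Ĝ y a b)
        ((Ĝ c a).comp (0 : E →L[ℝ] E) + ((Ĝ c).comp (0 : E →L[ℝ] E) + D.flip a).flip b) c :=
      h2a.clm_apply (hasFDerivAt_const b c)
    have heq := h1.unique (h2.congr_of_eventuallyEq hev)
    have hu := congrArg (fun T : E →L[ℝ] ℝ ↦ T u) heq
    simp only [_root_.add_apply, ContinuousLinearMap.comp_apply, ContinuousLinearMap.comp_zero,
      _root_.zero_apply, zero_add, ContinuousLinearMap.apply_apply,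
      ContinuousLinearMap.flip_apply] at hu
    rw [frameM_apply_c g₀ S B Ĝ c hpos hS hĜc, one_apply_eq_self, one_apply_eq_self] at hu
    exact hu
  -- conclusion: `R' u = 0`, so `M' = B`
  have hR'0 : ∀ u, R' u = 0 := by
    intro u
    refine ContinuousLinearMap.ext fun a ↦ bilin_ext g₀ hpos fun w ↦ ?_
    have h := hiso u a w
    rw [hM'u, hBg, _root_.add_apply, _root_.add_apply, map_add, _root_.add_apply, map_add,
      ← hsa u a w] at h
    rw [_root_.zero_apply, map_zero, _root_.zero_apply]
    linarith
  refine hMd.congr_fderiv ?_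
  ext u v
  rw [hM'u, hR'0, add_zero]

/-! #### `ℂ`-linearity -/

omit [CompleteSpace E] in
/-- `A y` commutes with `J` when `B` is `ℂ`-bilinear. [folklore] -/
theorem frameA_comm (J : E →L[ℝ] E) (hBJ : ∀ u v, B u (J v) = J (B u v)) (y : E) :
    A[y] * J = J * A[y] := by
  refine ContinuousLinearMap.ext fun v ↦ ?_
  rw [mul_apply_eq_comp, mul_apply_eq_comp, _root_.add_apply, _root_.add_apply, map_add,
    one_apply_eq_self, one_apply_eq_self, hBJ]

omit [CompleteSpace E] in
/-- `Q y` commutes with `J` when `g₀` and `Ĝ y` (at the point `y`) are Hermitian (`J` skew,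
`J² = -1`) and `B` is `ℂ`-bilinear. [folklore] -/
theorem frameQ_comm (hpos : ∀ a, a ≠ 0 → 0 < g₀ a a) (hS : ∀ ℓ w, g₀ (S ℓ) w = ℓ w)
    [FiniteDimensional ℝ E] (J : E →L[ℝ] E) (hJJ : ∀ v, J (J v) = -v)
    (hJskew : ∀ a b, g₀ (J a) b = -g₀ a (J b)) {y : E} (hĜJ : ∀ a b, Ĝ y (J a) (J b) = Ĝ y a b)
    (hBJ : ∀ u v, B u (J v) = J (B u v)) (hA : IsUnit A[y]) :
    Q[y] * J = J * Q[y] := by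
  -- `A y⁻¹` commutes with `J`
  have hcA : Commute J A[y] := (frameA_comm B c J hBJ y).symm
  have hcAi : ∀ v, Ai[y] (J v) = J (Ai[y] v) := fun v ↦ by
    have h := (hcA.units_inv_right (u := hA.unit))
    rw [show ((hA.unit⁻¹ : (E →L[ℝ] E)ˣ) : E →L[ℝ] E) = Ai[y] from (Ring.inverse_unit hA.unit).symm]
      at h
    exact (congrArg (fun T : E →L[ℝ] E ↦ T v) h.eq).symm
  -- Hermitian symmetry in mixed form: `Ĝ y (J x) z = -Ĝ y x (J z)`
  have hmix : ∀ x z, Ĝ y (J x) z = -Ĝ y x (J z) := fun x z ↦ by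
    have := hĜJ x (J z)
    rw [hJJ, map_neg] at this
    linarith
  refine ContinuousLinearMap.ext fun a ↦ bilin_ext g₀ hpos fun w ↦ ?_
  rw [mul_apply_eq_comp, mul_apply_eq_comp, frameQ_apply g₀ S B Ĝ c hS, hcAi, hJskew,
    frameQ_apply g₀ S B Ĝ c hS, hcAi, hmix]

omit [CompleteSpace E] in
/-- `J² = -1` as elements of the algebra. [folklore] -/
theorem J_mul_J (J : E →L[ℝ] E) (hJJ : ∀ v, J (J v) = -v) : J * J = -1 :=
  ContinuousLinearMap.ext fun v ↦ by
    rw [mul_apply_eq_comp, hJJ, _root_.neg_apply, one_apply_eq_self]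

/-- **`M y` is `ℂ`-linear near `c`**: `M y ∘ J = J ∘ M y`, for Hermitian `g₀`, `Ĝ y` Hermitian for
`y` near `c`, and `ℂ`-bilinear `B` (the square root of an operator commuting with the unit `J`
commutes with `J`). [cite: Voisin2002, Prop. 3.14] -/
theorem eventually_frameM_comm (hpos : ∀ a, a ≠ 0 → 0 < g₀ a a) (hS : ∀ ℓ w, g₀ (S ℓ) w = ℓ w)
    [FiniteDimensional ℝ E] (hĜc : Ĝ c = g₀) (hĜ : ContinuousAt Ĝ c) (J : E →L[ℝ] E)
    (hJJ : ∀ v, J (J v) = -v) (hJskew : ∀ a b, g₀ (J a) b = -g₀ a (J b))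
    (hĜJ : ∀ᶠ y in 𝓝 c, ∀ a b, Ĝ y (J a) (J b) = Ĝ y a b) (hBJ : ∀ u v, B u (J v) = J (B u v)) :
    ∀ᶠ y in 𝓝 c, M[y] * J = J * M[y] := by
  -- `J` as a unit of the algebra (`J⁻¹ = -J`)
  let Ju : (E →L[ℝ] E)ˣ := ⟨J, -J, by rw [mul_neg, J_mul_J J hJJ, neg_neg],
    by rw [neg_mul, J_mul_J J hJJ, neg_neg]⟩
  have hsq := (tendsto_frameQ g₀ S B Ĝ c hpos hS hĜc hĜ).eventually
    (eventually_localSqrt_comm_units Ju)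
  filter_upwards [hsq, eventually_isUnit_frameA B c, hĜJ] with y hy hA hĜJy
  have hQ : (Ju : E →L[ℝ] E) * Q[y] = Q[y] * Ju :=
    (frameQ_comm g₀ S B Ĝ c hpos hS J hJJ hJskew hĜJy hBJ hA).symm
  have hR : J * R[y] = R[y] * J := hy hQ
  rw [mul_assoc, frameA_comm B c J hBJ y, ← mul_assoc, ← hR, mul_assoc]

end FrameSqrt

end Literature.Geometry.Kaehler
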